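import Summits.QuantumAdvantage.QuantumAdvantage.Theorems.CubicForrelationNearExactIsExactTwelveLevelFiveResidualGt2932
import Summits.QuantumAdvantage.QuantumAdvantage.Theorems.CubicForrelationNearExactIsExactTwelveLevelSixBothGt930

/-!
# Crux `CubicForrelation.NearExactIsExact` (stmt-QuantumAdvantage-14043) — n = 12, a level-5 side anywhere in the window `Φ > 29/32`: its PARTNER is
  type O with a residual spike `|u_f − 4(−1)^g| ≥ 23` (PARAMETRIC reduction for the rungs `929/1024` and below)

Certificate seat `b2b-cforr-cert` (gen 20).  HONEST FRAMING: a kernel-checked structure theorem (standard axioms) about cubic Boolean pairs on 12 bits —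
the rung-independent part of the level-5 kill (…TwelveLevelFive930Dead proved the value `930/1024`; here the hypothesis is only `Φ > 29/32` and the
conclusion is a REDUCTION, not a contradiction).  Finite-slice infrastructure, NOT summit progress, NO new value of `θ₁₂` claimed here.

THEOREM `tw20_levelFive_gt2932_partner`: cubic `f, g` on 12 bits, `W_g = 32u'` with some `u'(x)` odd, `Φ(f,g) > 29/32`.  Then the partner `f` is
TYPE O — `W_f = 16·u_f` with every `u_f(y)` odd — and its residual `τ = u_f − 4(−1)^g` has a SPIKE: `|τ(y)| ≥ 23` at some `y`.
Proof: by `tw20_levelFive_gt2932_residual`, `W_f = 64(−1)^g − 32m − 4r̂` with `m ∈ {0, ±16, ±32}`, `m ≢ 0`, `|r̂| ≤ 21`, `Σ r̂² ≤ 86016`; Ax: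
`W_f = 16u_f`, so `r̂ = 4q`, `q ∈ ℤ`, `|q| ≤ 5`, `u_f = 4(−1)^g − 2m − q`.  If `u_f` is even, `f` is at level `≥ 5` and dies exactly as in
…TwelveLevelFive930Dead (odd hyperplane of `u_f/2` ⇒ `Σ r̂² ≥ 2048·64`; level `≥ 6` ⇒ bent (`tw_bent_end`) or `≥ 512` points with `|r̂| ≥ 16`).  So
`u_f` is odd (everywhere, the parity being constant at level 4); and if `|τ| = |2m + q| ≤ 22` everywhere then `|m| ≤ 13`, i.e. `m ≡ 0` —
impossible.  (At `Φ ≥ 930/1024` the spike contradicts zero excess at once; at `929/1024` it singles out the base-`512` boundary configuration of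
the type-O partner, see HOME/b2b-cforr-cert-g20/PLAN-N12-929.md.)

References: J. Ax (1964) / R. J. McEliece (1972); O. S. Rothaus (1976); MacWilliams–Sloane (1977) Ch. 13 §3, Ch. 14, Ch. 15 §2; C. Carlet (2021)
§4.1, §5.2, §6.1.  Everything below is proved from Mathlib and the tree; axioms are the standard three.
-/

set_option linter.dupNamespace false -- D-0017: single-problem summit ⇒ `QuantumAdvantage.QuantumAdvantage` by design

noncomputable section

namespace Summit.QuantumAdvantage.QuantumAdvantage.Theorems.CubicForrelation.NearExactIsExact

open Finset
open Literature.Computability.QuantumComplexity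
open Literature.Computability.QuantumComplexity.BuzetChailloux (bxor zeroVec bxor_zeroVec zeroVec_bxor bxor_comm twist_zeroVec_right twist_bxor_right)
open Literature.Computability.QuantumComplexity.DerivativeWalsh (W sum_W_sq)
open Literature.Computability.QuantumComplexity.Simon (twist_eq_one_or twist_mul_self)

/-- **The partner of a level-5 side at `Φ > 29/32` is type O with a residual spike `≥ 23`.**  See the module docstring.  Finite-slice
statement, NOT summit progress. [this work] -/
theorem tw20_levelFive_gt2932_partner (f g : (Fin (6 + 6) → Bool) → Bool) (hf : IsDegLeFun 3 f) (hg : IsDegLeFun 3 g)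
    (u' : (Fin (6 + 6) → Bool) → ℤ) (hu' : ∀ x, W (fun y => signOf (g y)) x = (2 : ℝ) ^ 5 * (u' x : ℝ))
    (hodd : ∃ x, Odd (u' x)) (hΦ : (29 / 32 : ℝ) < forrelation f g) :
    ∃ uf : (Fin (6 + 6) → Bool) → ℤ, (∀ y, W (fun x => signOf (f x)) y = (2 : ℝ) ^ 4 * (uf y : ℝ)) ∧ (∀ y, Odd (uf y)) ∧
      ∃ y, 23 ≤ |uf y - 4 * sZ (g y)| := by
  classical
  obtain ⟨γ, tg, D, r, m, htg, hγ0, hPg, hD, hroff, hu'form, hr20, hrabs, hrpars, hgran, hmne, hm, hWf, hΦlt⟩ :=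
    tw20_levelFive_gt2932_residual f g hf hg u' hu' hodd hΦ
  have hΦ' : forrelation g f = forrelation f g := by
    rw [Summit.QuantumAdvantage.QuantumAdvantage.Theorems.SignedCubicForrelationNotPrBPP.Negative.HalfQuad.forrelation_comm]
  have hlo' : (29 / 32 : ℝ) < forrelation g f := by rw [hΦ']; exact hΦ
  have hmeven : ∀ y, Even (m y) := by
    intro y
    rcases hgran y with h | h | h
    · rw [h]; exact ⟨0, rfl⟩
    · rcases abs_eq (by norm_num : (0 : ℤ) ≤ 16) |>.1 h with h' | h' <;> rw [h'] <;> decide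
    · rcases abs_eq (by norm_num : (0 : ℤ) ≤ 32) |>.1 h with h' | h' <;> rw [h'] <;> decide
  have hm4 : ∀ y, (4 : ℤ) ∣ m y := by
    intro y
    rcases hgran y with h | h | h
    · rw [h]; exact dvd_zero _
    · rcases abs_eq (by norm_num : (0 : ℤ) ≤ 16) |>.1 h with h' | h' <;> rw [h'] <;> decide
    · rcases abs_eq (by norm_num : (0 : ℤ) ≤ 32) |>.1 h with h' | h' <;> rw [h'] <;> decide
  -- Ax for `f` at level 4, and the integer `q = r̂/4`
  obtain ⟨uf, huf⟩ := tw_base (n := 6 + 6) f hf 4 (by norm_num)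
  set ρ : (Fin (6 + 6) → Bool) → ℝ := fun y => ∑ x, (r x : ℝ) * twist x y with hρdef
  set q : (Fin (6 + 6) → Bool) → ℤ := fun y => 4 * sZ (g y) - 2 * m y - uf y with hqdef
  have hρq : ∀ y, ρ y = 4 * (q y : ℝ) := by
    intro y
    have h1 := hWf y
    have h2 := huf y
    simp only [q]
    push_cast
    rw [tp_sZ_cast]
    change W (fun x => signOf (f x)) y = 64 * signOf (g y) - 32 * (m y : ℝ) - 4 * ρ y at h1
    rw [show (2 : ℝ) ^ 4 = 16 by norm_num] at h2
    linarith
  have hq5 : ∀ y, |q y| ≤ 5 := by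
    intro y
    have h := hrabs y
    change |ρ y| ≤ 21 at h
    rw [hρq y, abs_mul, abs_of_nonneg (by norm_num : (0 : ℝ) ≤ 4)] at h
    have : |(q y : ℝ)| < 6 := by linarith
    rw [← Int.cast_abs] at this
    have h6 : |q y| < 6 := by exact_mod_cast this
    omega
  -- `ρ² ≥ c` on a set of size `N` with `c·N > 86016` is impossible
  have hbig : ∀ (S : Finset (Fin (6 + 6) → Bool)) (c : ℝ), 0 ≤ c → (∀ y ∈ S, c ≤ ρ y ^ 2) → c * #S ≤ 86016 := by
    intro S c hc hS
    have h1 : ∑ y ∈ S, c ≤ ∑ y ∈ S, ρ y ^ 2 := sum_le_sum hS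
    rw [sum_const, nsmul_eq_mul, mul_comm] at h1
    have h2 : ∑ y ∈ S, ρ y ^ 2 ≤ ∑ y, ρ y ^ 2 := sum_le_sum_of_subset_of_nonneg (subset_univ S) fun y _ _ => sq_nonneg _
    have h3 : ∑ y, ρ y ^ 2 ≤ 86016 := hrpars
    linarith
  by_cases hO : ∃ y, Odd (uf y)
  · /- `f` is type O: all `u_f` odd; a bound `|u_f − 4(−1)^g| ≤ 22` everywhere would force `m ≡ 0` -/
    obtain ⟨y₁, hy₁⟩ := hO
    have hdeg := stub_walshTower stub_axParity (6 + 6) 4 0 f uf hf huf (by intro k hk hkn; omega)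
    have hallodd : ∀ y, Odd (uf y) := by
      intro y
      have h := tc_const_of_deg_zero hdeg y y₁
      have h1 : decide (Odd (uf y₁)) = true := by simpa using hy₁
      rw [h1] at h
      simpa using h
    refine ⟨uf, huf, hallodd, ?_⟩
    by_contra hsmall
    push Not at hsmall
    have hm0 : ∀ y, m y = 0 := by
      intro y
      have h1 : |uf y - 4 * sZ (g y)| < 23 := hsmall y
      have h2 := hq5 y
      have hτq : uf y - 4 * sZ (g y) = -2 * m y - q y := by simp only [q]; ring
      rw [hτq, abs_lt] at h1
      rw [abs_le] at h2
      rcases hgran y with h | h | h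
      · exact h
      · exfalso; rcases abs_eq (by norm_num : (0 : ℤ) ≤ 16) |>.1 h with h' | h' <;> rw [h'] at h1 <;> omega
      · exfalso; rcases abs_eq (by norm_num : (0 : ℤ) ≤ 32) |>.1 h with h' | h' <;> rw [h'] at h1 <;> omega
    obtain ⟨y₀, hy₀⟩ := hmne
    exact hy₀ (hm0 y₀)
  · /- `u_f` even: `f` at level `≥ 5` — impossible -/
    exfalso
    push Not at hO
    have huf5 := tw_level_up (j := 4) f uf huf hO
    have hev2 : ∀ y, uf y = 2 * (uf y / 2) := fun y =>
      (Int.mul_ediv_cancel' (even_iff_two_dvd.1 (Int.not_odd_iff_even.1 (hO y)))).symm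
    -- `ρ = 8 (2(−1)^g − m − u_f/2)`
    have hρ5 : ∀ y, ρ y = 8 * ((2 * sZ (g y) - m y - uf y / 2 : ℤ) : ℝ) := by
      intro y
      rw [hρq y]
      simp only [q]
      have h := hev2 y
      push_cast
      have h' : ((uf y : ℤ) : ℝ) = 2 * ((uf y / 2 : ℤ) : ℝ) := by exact_mod_cast h
      rw [h']
      ring
    by_cases hO5 : ∃ y, Odd (uf y / 2)
    · /- level exactly 5: the odd set is a hyperplane, and `ρ² ≥ 64` there -/
      obtain ⟨γ', t', ht', hγ'0, hPf⟩ := tw20_hyperplane_gt2932 g f hf (fun y => uf y / 2) huf5 hO5 hlo'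
      have hcard := tw59_card_half γ' hγ'0 t' ht'
      have h64 : ∀ y ∈ univ.filter (fun y : Fin (6 + 6) → Bool => twist γ' y = t'), (64 : ℝ) ≤ ρ y ^ 2 := by
        intro y hy
        have hyo : Odd (uf y / 2) := (hPf y).2 (mem_filter.1 hy).2
        rw [hρ5 y]
        have hne : (2 * sZ (g y) - m y - uf y / 2 : ℤ) ≤ -1 ∨ 1 ≤ (2 * sZ (g y) - m y - uf y / 2 : ℤ) := by
          obtain ⟨k, hk⟩ := hmeven y
          have h0 := Int.odd_iff.1 hyo
          rcases tp_sZ_cases (g y) with hs | hs <;> rw [hs] <;> omega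
        have hsq := tp_sq_ge (k := 1) (by norm_num) hne
        have : (1 : ℝ) ≤ ((2 * sZ (g y) - m y - uf y / 2 : ℤ) : ℝ) ^ 2 := by exact_mod_cast hsq
        nlinarith
      have := hbig _ 64 (by norm_num) h64
      rw [hcard] at this
      norm_num at this
    · /- level ≥ 6 -/
      push Not at hO5
      have huf6 := tw_level_up (j := 5) f (fun y => uf y / 2) huf5 hO5
      have hev4 : ∀ y, uf y / 2 = 2 * (uf y / 2 / 2) := fun y =>
        (Int.mul_ediv_cancel' (even_iff_two_dvd.1 (Int.not_odd_iff_even.1 (hO5 y)))).symm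
      set u6 : (Fin (6 + 6) → Bool) → ℤ := fun y => uf y / 2 / 2 with hu6def
      have huf6' : ∀ y, W (fun x => signOf (f x)) y = (2 : ℝ) ^ 6 * (u6 y : ℝ) := fun y => huf6 y
      have hρ6 : ∀ y, ρ y = 8 * ((2 * sZ (g y) - m y - 2 * u6 y : ℤ) : ℝ) := by
        intro y; rw [hρ5 y, hev4 y]
      by_cases hall : ∀ y, Odd (u6 y)
      · /- `f` bent-like: `Φ ∈ {1} ∪ [0, 7/8]` -/
        set u4 : (Fin (6 + 6) → Bool) → ℤ := fun y => 4 * u6 y with hu4def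
        have hu4 : ∀ y, W (fun x => signOf (f x)) y = (2 : ℝ) ^ 4 * (u4 y : ℝ) := by
          intro y; rw [huf6' y]; simp only [u4]; push_cast; ring
        have hpar : ∑ y, u6 y ^ 2 = 4096 := by
          have h := zms_sum_u_sq 2 f u4 (fun y => (hu4 y).trans (by norm_num))
          have e : ∑ y, ((u4 y : ℝ)) ^ 2 = 16 * ∑ y, ((u6 y : ℝ)) ^ 2 := by
            rw [mul_sum]; exact sum_congr rfl fun y _ => by simp only [u4]; push_cast; ring
          rw [e] at h
          norm_num at h
          have h' : ∑ y, ((u6 y : ℝ)) ^ 2 = 4096 := by linarith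
          exact_mod_cast h'
        have hsq1' : ∀ y, u6 y ^ 2 = 1 := by
          have hge : ∀ y, (1 : ℤ) ≤ u6 y ^ 2 := fun y => by
            have h0 := Int.odd_iff.1 (hall y)
            have : u6 y ≤ -1 ∨ 1 ≤ u6 y := by omega
            have := tp_sq_ge (k := 1) (by norm_num) this
            linarith
          have hsum0 : ∑ y, (u6 y ^ 2 - 1 : ℤ) = 0 := by
            rw [sum_sub_distrib, hpar, sum_const, card_univ, Fintype.card_fun, Fintype.card_bool, Fintype.card_fin]; norm_num
          intro y
          have := (sum_eq_zero_iff_of_nonneg fun z _ => by have := hge z; linarith).1 hsum0 y (mem_univ y)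
          linarith
        have hbent : ∀ y, W (fun x => signOf (f x)) y ^ 2 = (2 : ℝ) ^ (6 + 6) := by
          intro y
          rw [huf6' y, mul_pow]
          have : ((u6 y : ℝ)) ^ 2 = 1 := by exact_mod_cast hsq1' y
          rw [this]; norm_num
        rcases tw_bent_end (by norm_num) g f hg hf hbent with h | h
        · rw [hΦ'] at h; rw [h] at hΦlt; exact lt_irrefl _ hΦlt
        · rw [hΦ'] at h; norm_num at h; linarith
      · /- the even set of `u6` has `≥ 512` points, and `ρ² ≥ 256` there -/
        push Not at hall
        obtain ⟨y₁, hy₁⟩ := hall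
        have hp : IsDegLeFun 3 (fun y => decide (Odd (u6 y))) :=
          stub_walshTower stub_axParity (6 + 6) 6 3 f u6 hf huf6' (by intro k hk hkn; omega)
        have hp' : IsDegLeFun (2 + 1) (fun y => decide (Odd (u6 y)) ^^ true) := tb_isDegLeFun_xor_const hp true
        have hne : ∃ y, (decide (Odd (u6 y)) ^^ true) = true := ⟨y₁, by simpa using hy₁⟩
        have hRM := bb_rmWeight_holds (6 + 6) 3 (fun y => decide (Odd (u6 y)) ^^ true) hp' hne
        set Z := univ.filter (fun y : Fin (6 + 6) → Bool => (decide (Odd (u6 y)) ^^ true) = true) with hZdef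
        have hZge : 512 ≤ #Z := by norm_num at hRM; omega
        have h256 : ∀ y ∈ Z, (256 : ℝ) ≤ ρ y ^ 2 := by
          intro y hy
          have hye : ¬ Odd (u6 y) := by have := (mem_filter.1 hy).2; simpa using this
          obtain ⟨k, hk⟩ := Int.not_odd_iff_even.1 hye
          obtain ⟨k4, hk4⟩ := hm4 y
          rw [hρ6 y]
          have hne : (2 * sZ (g y) - m y - 2 * u6 y : ℤ) ≤ -2 ∨ 2 ≤ (2 * sZ (g y) - m y - 2 * u6 y : ℤ) := by
            rcases tp_sZ_cases (g y) with hs | hs <;> rw [hs] <;> omega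
          have hsq := tp_sq_ge (k := 2) (by norm_num) hne
          have : (4 : ℝ) ≤ ((2 * sZ (g y) - m y - 2 * u6 y : ℤ) : ℝ) ^ 2 := by exact_mod_cast hsq
          nlinarith
        have := hbig Z 256 (by norm_num) h256
        have hZge' : (512 : ℝ) ≤ (#Z : ℝ) := by exact_mod_cast hZge
        linarith

end Summit.QuantumAdvantage.QuantumAdvantage.Theorems.CubicForrelation.NearExactIsExact

end
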